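/-
Copyright (c) 2026 the pub-hodgecm-mathlib formalisation cell (harness21).  Prover seat hodgecm-mathlib-K2E4-p11 (g5), Track B ∕ K2-LIT, h413 =
`stmt-HodgeConjecture-24833`, line `K2_E1_TraceFormulaBeta`, campaign «EIS-RANK-ONE» ∕ R8-LADDER-2, «MS-2» — the LOWER-QUADRANT twin of ★ p858755
`poleControl_continued_cm_two_of_pairing` (dealer K2E1-plan (g5) DEAL 2026-09-04T09:03:54Z «the lower-quadrant twin of ★ p858755 rides as §0 of the same file or a 2nd
tiny file — your call»; my call 09:17Z: 2nd tiny file, one topic per file): pole control of the continued `c̃` on `D⁻ = {Re z > ½, Im z < 0}` by SCHWARZ REFLECTION into `D⁺`.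
-/
import Summits.HodgeConjecture.HodgeConjecture.Theorems.K2E1MaassSelbergContinuedCMTwo   -- ★ p858755: the `D⁺` head, `differentiableOn_conj_comp_conj`, `isOpen_upper∕lowerQuadrant`
import Literature.NumberTheory.Automorphic.IncompleteEisensteinSeries                    -- ★ `conj_ofReal_cpow` (`conj (y^s) = y^{conj s}`, `y ≥ 0`)
import HarnessLib

/-!
# h413 ∕ Track B «K2-LIT», «MS-2» — `K2E1MaassSelbergContinuedCMTwoLower`: pole control of the continued intertwining scalar `c̃` of `U(1,1)∕CM` on the LOWER quadrant
# `D⁻ = {Re z > ½, Im z < 0}`, modulo the sesqui-holomorphic pairing — the twin of ★ p858755 by Schwarz reflection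

Cell `pub/hodgecm-mathlib`, crux H413 = `stmt-HodgeConjecture-24833`, route `HCCMUnconditional`; dealer K2E1-plan (g5).  THEOREMS ONLY (no `def`, no `instance`, no `notation`,
no `sorry`); ONE named input (the pairing `Φ` on `D⁻`, exactly as in ★ p858755 with the quadrants exchanged); lane `--kind proof --supports stmt-HodgeConjecture-24833 --as helper`.
THE MATHEMATICS ([MoeglinWaldspurger1995, IV.3.12 (a)]).  ★ p858755 proves (a1)∧(a2)∧(a3) for `c̃` at `z ∈ D⁺ = {Re > ½, Im > 0}` from a pairing `Φ` holomorphic × antiholomorphic on `D⁺ × D⁺`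
that equals the four-term `R(z, z′; c̃, φ₀)` on the sub-tube and is `≥ 0` on the diagonal.  The conclusions only see `Re z`, `|Im z|`, `Im z²`, `‖c̃ z‖`, `‖φ₀‖`, all invariant under
`z ↦ conj z`; and the REFLECTED data `c♭(u) := conj c̃(conj u)`, `Φ♭(u,u′) := conj Φ(conj u, conj u′)`, `φ₀♭ := conj φ₀`, `Q♭(u) := Q(conj u)` on `D⁺` satisfy ★ p858755's hypotheses
whenever `c̃, Φ, Q` satisfy the mirror hypotheses on `D⁻` (Schwarz reflection ★ `differentiableOn_conj_comp_conj`; `conj(T^s) = T^{conj s}` for `T > 0`; `conj R(conj u, conj u′; c̃, φ₀)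
= R(u, u′; c♭, φ₀♭)`).  Hence:
* §1 `conj_mem_lowerQuadrant ∕ conj_mem_upperQuadrant` (bookkeeping; `conj (T^s) = T^{conj s}` is ★ `conj_ofReal_cpow`).
* §2 HEAD **`poleControl_continued_cm_two_of_pairing_lower`** — (a1)∧(a2)∧(a3) VERBATIM as in ★ p858755, for every `z ∈ D⁻`, modulo the pairing on `D⁻`: **`c̃` HAS NO POLE ON
  `½ < Re z ≤ 1` BELOW THE REAL AXIS EITHER and is `O(|y|⁻¹)` on vertical approach from below** — together with ★ p858755 this is [MW] IV.3.12 (a) continued on `{Re z > ½} ∖ ℝ`.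
HONEST LABEL.  Count-neutral helper; proves no printed statement; conditional on the named pairing `Φ` (σ1+σ2 ∕ P8 of the road, as for ★ p858755); HC_CM is proved only modulo the
7 printed citations (2 remaining named inputs: hLiu418 = `stmt-HodgeConjecture-24832`, h413 = `stmt-HodgeConjecture-24833`) until rung 0 closes.

## References
* [MoeglinWaldspurger1995] C. Mœglin, J.-L. Waldspurger, *Spectral decomposition and Eisenstein series* (1995), IV.2.3 (Maass–Selberg), IV.3.12 (a) (pole control; continuation argument).
* [Garrett2018] P. Garrett, *Modern Analysis of Automorphic Forms by Example* 1 (2018), §1.12, §11.3.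
-/

set_option autoImplicit false
set_option linter.dupNamespace false  -- the mandated namespace repeats the summit's segment (`HodgeConjecture.HodgeConjecture`)

noncomputable section

open scoped ComplexConjugate
open Literature.NumberTheory.Automorphic (conj_ofReal_cpow)
open Summit.HodgeConjecture.HodgeConjecture.Cruxes.H413.K2E1MaassSelbergContinuedCMTwo

namespace Summit.HodgeConjecture.HodgeConjecture.Cruxes.H413.K2E1MaassSelbergContinuedCMTwoLower

/-! ## §1 Reflection bookkeeping -/

section Reflection

/-- `conj` maps `D⁺` into `D⁻`. [folklore] -/
theorem conj_mem_lowerQuadrant {u : ℂ} (hu : u ∈ {z : ℂ | 1 / 2 < z.re ∧ 0 < z.im}) : conj u ∈ {w : ℂ | 1 / 2 < w.re ∧ w.im < 0} := by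
  obtain ⟨h1, h2⟩ := hu
  refine ⟨?_, ?_⟩
  · show 1 / 2 < (conj u).re
    rw [Complex.conj_re]; exact h1
  · show (conj u).im < 0
    rw [Complex.conj_im]; linarith

/-- `conj` maps `D⁻` into `D⁺`. [folklore] -/
theorem conj_mem_upperQuadrant {w : ℂ} (hw : w ∈ {w : ℂ | 1 / 2 < w.re ∧ w.im < 0}) : conj w ∈ {z : ℂ | 1 / 2 < z.re ∧ 0 < z.im} := by
  obtain ⟨h1, h2⟩ := hw
  refine ⟨?_, ?_⟩
  · show 1 / 2 < (conj w).re
    rw [Complex.conj_re]; exact h1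
  · show 0 < (conj w).im
    rw [Complex.conj_im]; linarith

end Reflection

/-! ## §2 HEAD: pole control of the continued `c̃` on the lower quadrant, modulo the pairing -/

section Head

/-- **POLE CONTROL OF THE CONTINUED `c̃` ON `D⁻ = {Re z > ½, Im z < 0}`, MODULO THE PAIRING** — the lower-quadrant twin of ★ p858755 `poleControl_continued_cm_two_of_pairing`.  Let `T ≥ 1`,
`cμ, K, κ, m > 0`, `φ₀ ≠ 0`; `c̃` holomorphic on `D⁻`; `Φ : ℂ → ℂ → ℂ` with `z ↦ Φ z z′` holomorphic on `D⁻` (`z′ ∈ D⁻`), `w ↦ Φ z (conj w)` holomorphic on `D⁺` (`z ∈ D⁻`), `Φ = R(·,·; c̃)`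
(the four-term right side of ★ (R6k)₂, verbatim as in ★ p858755) on the sub-tube `1 < Re z′ < Re z` inside `D⁻ × D⁻`, and `Φ z z = Q z ≥ 0` on `D⁻`.  Then at every `z ∈ D⁻`, with `x = Re z − ½`,
`y = Im z`, `a = κm|φ₀|²`, `b = κm|c̃ z|²|φ₀|²`: (a1) `√b ≤ x T^{2x} √a∕|y| + √(x²T^{4x}a∕y² + aT^{4x})`, (a2) the box bound on `x ∈ [x₁,x₂]`, `|y| ≥ η`, (a3) `b ≤ (…)²∕y²` for `|y| ≤ 1`.
PROOF: apply ★ p858755 at `conj z ∈ D⁺` to the reflected data `c♭ = conj ∘ c̃ ∘ conj`, `Φ♭(u,u′) = conj Φ(conj u, conj u′)`, `φ₀♭ = conj φ₀`, `Q♭ = Q ∘ conj` (Schwarz reflection ★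
`differentiableOn_conj_comp_conj`; `conj R(conj u, conj u′; c̃, φ₀) = R(u,u′; c♭, φ₀♭)` by ★ `conj_ofReal_cpow`), and read the conclusions back through `Re conj z = Re z`, `|Im conj z| = |Im z|`,
`‖conj ·‖ = ‖·‖`. [cite: MoeglinWaldspurger1995, IV.3.12 (a)] [cite: Garrett2018, §11.3] -/
theorem poleControl_continued_cm_two_of_pairing_lower {T cμ K κ m : ℝ} (hT : 1 ≤ T) (hcμ : 0 < cμ) (hK : 0 < K) (hκ : 0 < κ) (hm : 0 < m) {φ₀ : ℂ} (hφ₀ : φ₀ ≠ 0)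
    {c : ℂ → ℂ} (hc : DifferentiableOn ℂ c {w : ℂ | 1 / 2 < w.re ∧ w.im < 0})
    {Φ : ℂ → ℂ → ℂ}
    (hΦ₁ : ∀ z' ∈ {w : ℂ | 1 / 2 < w.re ∧ w.im < 0}, DifferentiableOn ℂ (fun z : ℂ => Φ z z') {w : ℂ | 1 / 2 < w.re ∧ w.im < 0})
    (hΦ₂ : ∀ z ∈ {w : ℂ | 1 / 2 < w.re ∧ w.im < 0}, DifferentiableOn ℂ (fun w : ℂ => Φ z (conj w)) {z : ℂ | 1 / 2 < z.re ∧ 0 < z.im})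
    (hrel : ∀ z ∈ {w : ℂ | 1 / 2 < w.re ∧ w.im < 0}, ∀ z' ∈ {w : ℂ | 1 / 2 < w.re ∧ w.im < 0}, 1 < z'.re → z'.re < z.re →
      Φ z z' = ((cμ : ℝ) : ℂ) * (((K : ℝ) : ℂ) *
        ((((T : ℝ) : ℂ) ^ (z + conj z' - 1) / (z + conj z' - 1)) * (((κ : ℝ) : ℂ) * (((m : ℝ) : ℂ) * (φ₀ * conj φ₀)))
          + (((T : ℝ) : ℂ) ^ (z - conj z') / (z - conj z')) * (((κ : ℝ) : ℂ) * (((m : ℝ) : ℂ) * (φ₀ * conj (c z' * φ₀))))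
          - (((T : ℝ) : ℂ) ^ (-(z - conj z')) / (z - conj z')) * (((κ : ℝ) : ℂ) * (((m : ℝ) : ℂ) * (c z * φ₀ * conj φ₀)))
          - (((T : ℝ) : ℂ) ^ (-(z + conj z' - 1)) / (z + conj z' - 1)) * (((κ : ℝ) : ℂ) * (((m : ℝ) : ℂ) * (c z * φ₀ * conj (c z' * φ₀)))))))
    {Q : ℂ → ℝ} (hQ : ∀ z ∈ {w : ℂ | 1 / 2 < w.re ∧ w.im < 0}, 0 ≤ Q z ∧ Φ z z = ((Q z : ℝ) : ℂ))
    {z : ℂ} (hz : z ∈ {w : ℂ | 1 / 2 < w.re ∧ w.im < 0}) :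
    Real.sqrt (κ * m * ‖c z‖ ^ 2 * ‖φ₀‖ ^ 2) ≤ (z.re - 1 / 2) * T ^ (2 * (z.re - 1 / 2)) * Real.sqrt (κ * m * ‖φ₀‖ ^ 2) / |z.im| +
        Real.sqrt ((z.re - 1 / 2) ^ 2 * T ^ (4 * (z.re - 1 / 2)) * (κ * m * ‖φ₀‖ ^ 2) / z.im ^ 2 + (κ * m * ‖φ₀‖ ^ 2) * T ^ (4 * (z.re - 1 / 2))) ∧
      (∀ {x₁ x₂ η : ℝ}, 0 < x₁ → (z.re - 1 / 2) ∈ Set.Icc x₁ x₂ → 0 < η → η ≤ |z.im| →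
        κ * m * ‖c z‖ ^ 2 * ‖φ₀‖ ^ 2 ≤ (x₂ * T ^ (2 * x₂) * Real.sqrt (κ * m * ‖φ₀‖ ^ 2) / η + Real.sqrt (x₂ ^ 2 * T ^ (4 * x₂) * (κ * m * ‖φ₀‖ ^ 2) / η ^ 2 + (κ * m * ‖φ₀‖ ^ 2) * T ^ (4 * x₂))) ^ 2) ∧
      (|z.im| ≤ 1 → κ * m * ‖c z‖ ^ 2 * ‖φ₀‖ ^ 2 ≤ ((z.re - 1 / 2) * T ^ (2 * (z.re - 1 / 2)) * Real.sqrt (κ * m * ‖φ₀‖ ^ 2) +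
        Real.sqrt ((z.re - 1 / 2) ^ 2 * T ^ (4 * (z.re - 1 / 2)) * (κ * m * ‖φ₀‖ ^ 2) + (κ * m * ‖φ₀‖ ^ 2) * T ^ (4 * (z.re - 1 / 2)))) ^ 2 / z.im ^ 2) := by
  have hT0 : 0 ≤ T := le_trans zero_le_one hT
  have hTc : ∀ s : ℂ, conj (((T : ℝ) : ℂ) ^ s) = ((T : ℝ) : ℂ) ^ (conj s) := fun s => conj_ofReal_cpow hT0 s
  -- (1) the reflected data on `D⁺`
  have hcr : DifferentiableOn ℂ (fun u : ℂ => conj (c (conj u))) {z : ℂ | 1 / 2 < z.re ∧ 0 < z.im} :=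
    (differentiableOn_conj_comp_conj isOpen_lowerQuadrant hc).mono fun u hu => conj_mem_lowerQuadrant hu
  have hΦ₁r : ∀ u' ∈ {z : ℂ | 1 / 2 < z.re ∧ 0 < z.im}, DifferentiableOn ℂ (fun u : ℂ => conj (Φ (conj u) (conj u'))) {z : ℂ | 1 / 2 < z.re ∧ 0 < z.im} := fun u' hu' =>
    (differentiableOn_conj_comp_conj isOpen_lowerQuadrant (hΦ₁ (conj u') (conj_mem_lowerQuadrant hu'))).mono fun u hu => conj_mem_lowerQuadrant hu
  have hΦ₂r : ∀ u ∈ {z : ℂ | 1 / 2 < z.re ∧ 0 < z.im}, DifferentiableOn ℂ (fun w : ℂ => conj (Φ (conj u) (conj (conj w)))) {w : ℂ | 1 / 2 < w.re ∧ w.im < 0} := fun u hu =>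
    (differentiableOn_conj_comp_conj isOpen_upperQuadrant (hΦ₂ (conj u) (conj_mem_lowerQuadrant hu))).mono fun w hw => conj_mem_upperQuadrant hw
  have hrelr : ∀ u ∈ {z : ℂ | 1 / 2 < z.re ∧ 0 < z.im}, ∀ u' ∈ {z : ℂ | 1 / 2 < z.re ∧ 0 < z.im}, 1 < u'.re → u'.re < u.re →
      conj (Φ (conj u) (conj u')) = ((cμ : ℝ) : ℂ) * (((K : ℝ) : ℂ) *
        ((((T : ℝ) : ℂ) ^ (u + conj u' - 1) / (u + conj u' - 1)) * (((κ : ℝ) : ℂ) * (((m : ℝ) : ℂ) * (conj φ₀ * conj (conj φ₀))))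
          + (((T : ℝ) : ℂ) ^ (u - conj u') / (u - conj u')) * (((κ : ℝ) : ℂ) * (((m : ℝ) : ℂ) * (conj φ₀ * conj (conj (c (conj u')) * conj φ₀))))
          - (((T : ℝ) : ℂ) ^ (-(u - conj u')) / (u - conj u')) * (((κ : ℝ) : ℂ) * (((m : ℝ) : ℂ) * (conj (c (conj u)) * conj φ₀ * conj (conj φ₀))))
          - (((T : ℝ) : ℂ) ^ (-(u + conj u' - 1)) / (u + conj u' - 1)) * (((κ : ℝ) : ℂ) * (((m : ℝ) : ℂ) * (conj (c (conj u)) * conj φ₀ * conj (conj (c (conj u')) * conj φ₀)))))) := by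
    intro u hu u' hu' h1 h2
    rw [hrel (conj u) (conj_mem_lowerQuadrant hu) (conj u') (conj_mem_lowerQuadrant hu') (by rw [Complex.conj_re]; exact h1) (by rw [Complex.conj_re, Complex.conj_re]; exact h2)]
    simp only [map_mul, map_sub, map_add, map_div₀, map_neg, map_one, Complex.conj_ofReal, Complex.conj_conj, hTc]
  have hQr : ∀ u ∈ {z : ℂ | 1 / 2 < z.re ∧ 0 < z.im}, 0 ≤ Q (conj u) ∧ conj (Φ (conj u) (conj u)) = ((Q (conj u) : ℝ) : ℂ) := fun u hu => by
    obtain ⟨h0, heq⟩ := hQ (conj u) (conj_mem_lowerQuadrant hu)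
    exact ⟨h0, by rw [heq, Complex.conj_ofReal]⟩
  -- (2) ★ p858755 at `conj z ∈ D⁺`, read back
  have hmain := poleControl_continued_cm_two_of_pairing hT hcμ hK hκ hm (φ₀ := conj φ₀) ((map_ne_zero_iff _ (RingHom.injective _)).2 hφ₀)
    (c := fun u : ℂ => conj (c (conj u))) hcr (Φ := fun u u' : ℂ => conj (Φ (conj u) (conj u'))) hΦ₁r hΦ₂r hrelr (Q := fun u : ℂ => Q (conj u)) hQr
    (z := conj z) (conj_mem_upperQuadrant hz)
  simpa only [Complex.conj_re, Complex.conj_im, abs_neg, neg_sq, Complex.conj_conj, Complex.norm_conj] using hmain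

end Head

end Summit.HodgeConjecture.HodgeConjecture.Cruxes.H413.K2E1MaassSelbergContinuedCMTwoLower

end
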